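import Mathlib
import Summits.KontsevichZagierPeriods.KontsevichZagierPeriods.Theorems.SoloInformedHarmonicLabels
import Summits.KontsevichZagierPeriods.KontsevichZagierPeriods.Theorems.SoloInformedKZStokesSimplexCells
import Literature.NumberTheory.Transcendental.MultipleZetaDepthTwoProofs
import HarnessLib
import HarnessLib.Audit

/-!
# SoloInformed — the harmonic product in the formal period ring: the representations

Solo programme `solo-KontsevichZagierPeriods-informed`, session s47 (PROGRAMME XLVI, file 6).

In `𝒫 = KZ.FormalPeriodRing` we realise Hoffman's harmonic product of a letter with a word by
naive moves.  The Fubini product `CubeW u × CubeW (a+2)` (file 1), relabelled to the cube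
`(0,1)^{M+1}` (`M + 1 = (m+1) + (a+2)`), has integrand `G(Q₀,…,Q_k) · 1/(1−Y)` with `Q_t` the
`u`-prefix products and `Y` the product of the `X`-coordinates (`soloInformed_hProd_integrand`).
By the rational identity of file 2 this is the sum of the `G`'s of the inserted and merged
chains, which are the integrands of the representations `BRep (LabIns i)`, `BRep (LabMerge i)`
of files 4–5 (`soloInformed_hIns_integrand`, `soloInformed_hMerge_integrand`).  Rule (1b),
iterated (`soloInformed_of_sub_sum_mem_relations`, THEOREM XXXI's kit), then gives in `𝒫`

  `mzvClass u · mzvClass (a+2) = Σ_{i ≤ k+1} mzvClass (u.take i ++ (a+2) :: u.drop i)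
                                 + Σ_{i ≤ k} mzvClass (u.take i ++ ((a+2)+u_i) :: u.drop (i+1))`

(`soloInformed_mzvClass_mul_letter_raw`); file 7 re-indexes the right side by `MZV.stuffle`.

References: Hoffman 1997 §2; Hoffman 1992 §2; Kontsevich–Zagier 2001 §1.2; Zagier 1994 §9.
-/

noncomputable section

open MeasureTheory Set
open Literature.NumberTheory.Transcendental
open Literature.NumberTheory.Transcendental.KZ

namespace Summit.KontsevichZagierPeriods.KontsevichZagierPeriods.Theorems

/-! ## 1. Products over coordinate sets of the cube -/

section cubeprod

variable {N : ℕ}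

/-- A product of cube coordinates over a nonempty set lies in `(0,1)`. -/
theorem soloInformed_prod_filter_mem_Ioo {w : Fin N → ℝ} (hw : w ∈ soloInformedOpenCube N)
    {S : Finset (Fin N)} (hS : S.Nonempty) : 0 < ∏ l ∈ S, w l ∧ ∏ l ∈ S, w l < 1 := by
  refine ⟨Finset.prod_pos fun l _ => (hw l).1, ?_⟩
  obtain ⟨l₀, h0⟩ := hS
  rw [← Finset.mul_prod_erase _ _ h0]
  have h1 : ∏ l ∈ S.erase l₀, w l ≤ 1 := Finset.prod_le_one (fun l _ => (hw l).1.le) fun l _ => (hw l).2.le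
  have h2 : 0 < ∏ l ∈ S.erase l₀, w l := Finset.prod_pos fun l _ => (hw l).1
  nlinarith [(hw l₀).1, (hw l₀).2]

end cubeprod

/-! ## 2. The product representation -/

section prod

variable (M : ℕ) {m a k : ℕ} (u : List ℕ) (hu : MZV.IsAdmissible u) (hw : MZV.weight u = m + 1)
  (hk : u.length = k + 1) (hM : m + a + 2 = M)

/-- The letter index `(a+2)` has weight `a+2 = (a+1)+1`. -/
theorem soloInformed_letter_weight (a : ℕ) : MZV.weight [a + 2] = a + 1 + 1 := by
  simp [MZV.weight]

include hM in
/-- The dimension count `(m+1) + (a+2) = M+1`. -/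
theorem soloInformed_hDim : (m + 1) + (a + 1 + 1) = M + 1 := by omega

/-- `HProd = CubeW u × CubeW (a+2)`, relabelled to `Fin (M+1)`. -/
def soloInformedHProd : IntegralRep (M + 1) :=
  ((soloInformedCubeW u hu hw).prod (soloInformedCubeW [a + 2]
    (MZV.isAdmissible_singleton_of_two_le (Nat.le_add_left 2 a))
    (soloInformed_letter_weight a))).reindex (finCongr (soloInformed_hDim M hM))

/-- The domain of `HProd` is the cube. -/
theorem soloInformed_hProd_domain :
    (soloInformedHProd M u hu hw hM).domain = soloInformedOpenCube (M + 1) := by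
  ext w
  simp only [soloInformedHProd, IntegralRep.reindex_domain, IntegralRep.prod_domain,
    IntegralRep.mem_prodDomain, mem_setOf_eq, soloInformedCubeW_domain]
  constructor
  · rintro ⟨h1, h2⟩ l
    obtain ⟨i, rfl⟩ := (finCongr (soloInformed_hDim M hM)).surjective l
    induction i using Fin.addCases with
    | left i => exact h1 i
    | right j => exact h2 j
  · exact fun h => ⟨fun i => h _, fun j => h _⟩

/-- The `u`-prefix products of the relabelled point are the `Q_t`. -/
theorem soloInformed_PP_castAdd (w : Fin (M + 1) → ℝ) {j : ℕ} (hj : j < m + 1) :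
    soloInformedPP (fun i : Fin (m + 1) => w (finCongr (soloInformed_hDim M hM) (Fin.castAdd (a + 1 + 1) i))) j =
      ∏ l ∈ Finset.univ.filter (fun l : Fin (M + 1) => l.1 ≤ j), w l := by
  unfold soloInformedPP
  have hinj : ∀ x ∈ Finset.univ.filter (fun i : Fin (m + 1) => i.1 ≤ j),
      ∀ y ∈ Finset.univ.filter (fun i : Fin (m + 1) => i.1 ≤ j),
      finCongr (soloInformed_hDim M hM) (Fin.castAdd (a + 1 + 1) x) =
        finCongr (soloInformed_hDim M hM) (Fin.castAdd (a + 1 + 1) y) → x = y := fun x _ y _ h => by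
    simpa [Fin.ext_iff] using h
  rw [← Finset.prod_image hinj]
  refine Finset.prod_congr ?_ fun _ _ => rfl
  ext l
  simp only [Finset.mem_image, Finset.mem_filter, Finset.mem_univ, true_and, Fin.ext_iff,
    finCongr_apply, Fin.val_cast, Fin.val_castAdd]
  exact ⟨fun ⟨x, hx, hxl⟩ => by omega, fun hl => ⟨⟨l.1, by omega⟩, by simp only; omega, rfl⟩⟩

/-- The `X`-block product of the relabelled point is `Y`. -/
theorem soloInformed_prefix_natAdd (w : Fin (M + 1) → ℝ) :
    soloInformedPrefixProd (fun j : Fin (a + 1 + 1) => w (finCongr (soloInformed_hDim M hM)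
        (Fin.natAdd (m + 1) j))) (Fin.last (a + 1)) = soloInformedYB M m w := by
  unfold soloInformedPrefixProd soloInformedYB
  rw [Finset.filter_true_of_mem fun i _ => Fin.le_last i]
  have hinj : ∀ x ∈ (Finset.univ : Finset (Fin (a + 1 + 1))), ∀ y ∈ (Finset.univ : Finset (Fin (a + 1 + 1))),
      finCongr (soloInformed_hDim M hM) (Fin.natAdd (m + 1) x) =
        finCongr (soloInformed_hDim M hM) (Fin.natAdd (m + 1) y) → x = y := fun x _ y _ h => by
    simpa [Fin.ext_iff] using h
  rw [← Finset.prod_image hinj]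
  refine Finset.prod_congr ?_ fun _ _ => rfl
  ext l
  simp only [Finset.mem_image, Finset.mem_univ, true_and, Finset.mem_filter, Fin.ext_iff,
    finCongr_apply, Fin.val_cast, Fin.val_natAdd]
  exact ⟨fun ⟨x, hxl⟩ => by omega, fun hl => ⟨⟨l.1 - (m + 1), by omega⟩, by simp only; omega⟩⟩

include hk in
/-- **The integrand of `HProd` is `G(Q₀,…,Q_k) · 1/(1 − Y)`.** -/
theorem soloInformed_hProd_integrand (w : Fin (M + 1) → ℝ) :
    (soloInformedHProd M u hu hw hM).integrand w =
      soloInformedGQ (List.ofFn fun t : Fin (k + 1) => soloInformedQU M u w t) *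
        (1 / (1 - soloInformedYB M m w)) := by
  simp only [soloInformedHProd, IntegralRep.reindex_integrand, IntegralRep.prod_integrand_eq,
    IntegralRep.prodFun_apply, soloInformedCubeW_integrand]
  rw [soloInformed_cubeWf_eq_GQ hu.1 hw hk, soloInformed_cubeWf_single, soloInformed_prefix_natAdd M hM w]
  congr 1
  congr 1
  refine List.ofFn_inj.2 (funext fun t => ?_)
  have h1 := soloInformed_one_le_ends_getD hu.1 (show (t : ℕ) < u.length by omega)
  have h2 := soloInformed_ends_getD_le_weight hu.1 hw hk (t : ℕ)
  rw [soloInformed_PP_castAdd M hM w (by omega), soloInformedQU]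
  refine Finset.prod_congr ?_ fun _ _ => rfl
  ext l
  simp only [Finset.mem_filter, Finset.mem_univ, true_and]
  omega

/-- **`⟦HProd⟧ = mzvClass u · mzvClass (a+2)`** (rule (2), Fubini, file 1). -/
theorem soloInformed_hProd_class :
    toFormalPeriod (of (soloInformedHProd M u hu hw hM)) = mzvClass u * mzvClass [a + 2] := by
  rw [← soloInformed_cubeW_class u hu hw, ← soloInformed_cubeW_class [a + 2]
    (MZV.isAdmissible_singleton_of_two_le (Nat.le_add_left 2 a)) (soloInformed_letter_weight a),
    ← map_mul, of_mul_of, eq_comm,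
    toFormalPeriod_eq_iff]
  exact of_sub_of_reindex_mem_relations _ _

end prod

/-! ## 3. The term representations and their integrands -/

section terms

variable (M : ℕ) {m a k : ℕ} (u : List ℕ) (hu : MZV.IsAdmissible u) (hw : MZV.weight u = m + 1)
  (hk : u.length = k + 1) (hM : m + a + 2 = M)

/-- The insertion term `HIns i = BRep (LabIns i)`, `0 ≤ i ≤ k+1`. -/
def soloInformedHIns (i : Fin (k + 2)) : IntegralRep (M + 1) :=
  soloInformedBRep (soloInformedLabIns M u m i)
    (soloInformed_isLab_labIns M hu hw hk hM (Nat.le_of_lt_succ i.2))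

/-- The merging term `HMerge i = BRep (LabMerge i)`, `0 ≤ i ≤ k`. -/
def soloInformedHMerge (i : Fin (k + 1)) : IntegralRep (M + 1) :=
  soloInformedBRep (soloInformedLabMerge M u m i)
    (soloInformed_isLab_labMerge M hu hw hk hM (Nat.le_of_lt_succ i.2))

include hu hw hk hM in
/-- **The chain of `LabIns i` is `ins_i(Y; Q)`.** -/
theorem soloInformed_ofFn_BP_labIns (i : Fin (k + 2)) (w : Fin (M + 1) → ℝ) :
    List.ofFn (fun t : Fin (k + 2) => soloInformedBP (soloInformedLabIns M u m i) w t) =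
      soloInformedInsQ (soloInformedYB M m w) 1 (List.ofFn fun t : Fin (k + 1) => soloInformedQU M u w t) i := by
  apply List.ext_getElem?
  intro r
  rw [List.getElem?_ofFn, soloInformed_getElem?_insQ _ _ _ _ _ (by simp; omega)]
  by_cases hr : r < k + 2
  · rw [dif_pos hr, soloInformed_BP_labIns M hu hw hk hM (Nat.le_of_lt_succ i.2) w (by omega : r ≤ k + 1)]
    by_cases h1 : r < i
    · rw [if_pos h1, if_pos h1, List.getElem?_ofFn, dif_pos (by omega)]
    rw [if_neg h1, if_neg h1]
    by_cases h2 : r = i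
    · rw [if_pos h2, ← h2]
      rcases Nat.eq_zero_or_pos r with rfl | hpos
      · rw [if_pos rfl, List.getD_cons_zero]
      · obtain ⟨s, rfl⟩ : ∃ s, r = s + 1 := ⟨r - 1, by omega⟩
        rw [if_neg (by omega), List.getD_cons_succ, List.getD_eq_getElem _ _ (by simp; omega),
          List.getElem_ofFn, Nat.add_sub_cancel]
    · rw [if_neg h2, if_neg (by omega : r ≠ 0), List.getElem?_ofFn, dif_pos (by omega : r - 1 < k + 1)]
      rfl
  · rw [dif_neg hr, if_neg (by omega), if_neg (by omega), List.getElem?_ofFn, dif_neg (by omega)]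
    rfl

include hu hw hk hM in
/-- **The chain of `LabMerge i` is `merge_i(Y; Q)`.** -/
theorem soloInformed_ofFn_BP_labMerge (i : Fin (k + 1)) (w : Fin (M + 1) → ℝ) :
    List.ofFn (fun t : Fin (k + 1) => soloInformedBP (soloInformedLabMerge M u m i) w t) =
      soloInformedMergeQ (soloInformedYB M m w) (List.ofFn fun t : Fin (k + 1) => soloInformedQU M u w t) i := by
  apply List.ext_getElem?
  intro r
  rw [List.getElem?_ofFn, soloInformed_getElem?_mergeQ, List.getElem?_ofFn]
  by_cases hr : r < k + 1
  · rw [dif_pos hr, dif_pos hr, soloInformed_BP_labMerge M hu hw hk hM w (by omega : r ≤ k)]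
    split_ifs with h1
    · rfl
    · rfl
  · rw [dif_neg hr, dif_neg hr]
    split_ifs <;> rfl

/-- The integrand of `HIns i` is `G(ins_i(Y; Q))`. -/
theorem soloInformed_hIns_integrand (i : Fin (k + 2)) (w : Fin (M + 1) → ℝ) :
    (soloInformedHIns M u hu hw hk hM i).integrand w =
      soloInformedGQ (soloInformedInsQ (soloInformedYB M m w) 1
        (List.ofFn fun t : Fin (k + 1) => soloInformedQU M u w t) i) := by
  rw [soloInformedHIns, soloInformed_bRep_integrand, soloInformed_ofFn_BP_labIns M u hu hw hk hM]

/-- The integrand of `HMerge i` is `G(merge_i(Y; Q))`. -/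
theorem soloInformed_hMerge_integrand (i : Fin (k + 1)) (w : Fin (M + 1) → ℝ) :
    (soloInformedHMerge M u hu hw hk hM i).integrand w =
      soloInformedGQ (soloInformedMergeQ (soloInformedYB M m w)
        (List.ofFn fun t : Fin (k + 1) => soloInformedQU M u w t) i) := by
  rw [soloInformedHMerge, soloInformed_bRep_integrand, soloInformed_ofFn_BP_labMerge M u hu hw hk hM]

/-- `⟦HIns i⟧ = mzvClass (u.take i ++ (a+2) :: u.drop i)`. -/
theorem soloInformed_hIns_class (i : Fin (k + 2)) :
    toFormalPeriod (of (soloInformedHIns M u hu hw hk hM i)) =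
      mzvClass (u.take i ++ (a + 2) :: u.drop i) := by
  rw [soloInformedHIns, soloInformed_bRep_class,
    soloInformed_idx_labIns M hu hw hk hM (Nat.le_of_lt_succ i.2)]

/-- `⟦HMerge i⟧ = mzvClass (u.take i ++ ((a+2) + u_i) :: u.drop (i+1))`. -/
theorem soloInformed_hMerge_class (i : Fin (k + 1)) :
    toFormalPeriod (of (soloInformedHMerge M u hu hw hk hM i)) =
      mzvClass (u.take i ++ ((a + 2) + u[(i : ℕ)]'(by omega)) :: u.drop (i + 1)) := by
  rw [soloInformedHMerge, soloInformed_bRep_class,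
    soloInformed_idx_labMerge M hu hw hk hM (Nat.le_of_lt_succ i.2)]

/-! ## 4. The pointwise identity and the class identity (rule (1b), iterated) -/

/-- **On the cube, the integrand of `HProd` is the sum of the term integrands.** -/
theorem soloInformed_hProd_integrand_eq_sum {w : Fin (M + 1) → ℝ}
    (hwc : w ∈ soloInformedOpenCube (M + 1)) :
    (soloInformedHProd M u hu hw hM).integrand w =
      ∑ i : Fin (k + 2), (soloInformedHIns M u hu hw hk hM i).integrand w +
        ∑ i : Fin (k + 1), (soloInformedHMerge M u hu hw hk hM i).integrand w := by
  have hY : 0 ≤ soloInformedYB M m w ∧ soloInformedYB M m w < 1 := by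
    have h := soloInformed_prod_filter_mem_Ioo hwc
      (S := Finset.univ.filter (fun l : Fin (M + 1) => m + 1 ≤ l.1))
      ⟨Fin.last M, Finset.mem_filter.2 ⟨Finset.mem_univ _, by rw [Fin.val_last]; omega⟩⟩
    exact ⟨h.1.le, h.2⟩
  have hQ : ∀ q ∈ (List.ofFn fun t : Fin (k + 1) => soloInformedQU M u w t), 0 ≤ q ∧ q < 1 := by
    intro q hq
    rw [List.mem_ofFn] at hq
    obtain ⟨t, rfl⟩ := hq
    have h1 := soloInformed_one_le_ends_getD hu.1 (show (t : ℕ) < u.length by omega)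
    have h := soloInformed_prod_filter_mem_Ioo hwc
      (S := Finset.univ.filter (fun l : Fin (M + 1) => l.1 < (soloInformedEnds u).getD t 0))
      ⟨⟨0, by omega⟩, Finset.mem_filter.2 ⟨Finset.mem_univ _, h1⟩⟩
    exact ⟨h.1.le, h.2⟩
  have h := soloInformed_harmonicGQ hY _ hQ
  rw [List.length_ofFn, ← Fin.sum_univ_eq_sum_range, ← Fin.sum_univ_eq_sum_range] at h
  rw [soloInformed_hProd_integrand M u hu hw hk hM, mul_comm, ← h]
  simp only [soloInformed_hIns_integrand, soloInformed_hMerge_integrand]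

/-- **`[HProd] − Σ [HIns i] − Σ [HMerge i] ∈ relations`** (rule (1b), `2k+3` summands). -/
theorem soloInformed_hProd_move :
    of (soloInformedHProd M u hu hw hM) -
      (∑ i : Fin (k + 2), of (soloInformedHIns M u hu hw hk hM i) +
        ∑ i : Fin (k + 1), of (soloInformedHMerge M u hu hw hk hM i)) ∈ relations := by
  have h := soloInformed_of_sub_sum_mem_relations (soloInformedHProd M u hu hw hM)
    (Fin.addCases (fun i : Fin (k + 2) => soloInformedHIns M u hu hw hk hM i)
      fun i : Fin (k + 1) => soloInformedHMerge M u hu hw hk hM i)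
    (fun i => by
      rw [soloInformed_hProd_domain]
      induction i using Fin.addCases with
      | left i => rw [Fin.addCases_left]; exact soloInformed_bRep_domain _ _
      | right i => rw [Fin.addCases_right]; exact soloInformed_bRep_domain _ _)
    (fun w hwc => by
      rw [soloInformed_hProd_domain] at hwc
      dsimp only
      rw [Fin.sum_univ_add]
      simp only [Fin.addCases_left, Fin.addCases_right]
      exact soloInformed_hProd_integrand_eq_sum M u hu hw hk hM hwc)
  rw [Fin.sum_univ_add] at h
  simpa only [Fin.addCases_left, Fin.addCases_right] using h

end terms

section raw

variable {m a k : ℕ} {u : List ℕ} (hu : MZV.IsAdmissible u) (hw : MZV.weight u = m + 1)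
  (hk : u.length = k + 1)

include hu hw hk in
/-- **The harmonic product in `𝒫`, raw form.** For `u = (u₀,…,u_k)` admissible and `a`,

  `mzvClass u · mzvClass (a+2) = Σ_{i ≤ k+1} mzvClass (u.take i ++ (a+2) :: u.drop i)
                                 + Σ_{i ≤ k} mzvClass (u.take i ++ ((a+2)+u_i) :: u.drop (i+1))`.
-/
theorem soloInformed_mzvClass_mul_letter_raw :
    mzvClass u * mzvClass [a + 2] =
      ∑ i : Fin (k + 2), mzvClass (u.take i ++ (a + 2) :: u.drop i) +
        ∑ i : Fin (k + 1), mzvClass (u.take i ++ ((a + 2) + u[(i : ℕ)]'(by omega)) :: u.drop (i + 1)) := by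
  have h := toFormalPeriod_eq_iff.2 (soloInformed_hProd_move (m + a + 2) u hu hw hk rfl)
  rw [soloInformed_hProd_class, map_add, map_sum, map_sum] at h
  rw [h]
  simp only [soloInformed_hIns_class, soloInformed_hMerge_class]

end raw

end Summit.KontsevichZagierPeriods.KontsevichZagierPeriods.Theorems
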